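import Literature.MathematicalPhysics.QuantumFieldTheory.Balaban1983to89.T4ActivityLipschitz
import Summits.QuantumFields.BalabanUV.T4Continuum.Spine.NE1p.DressedSmallFieldSeries

/-!
# T⁴ programme, spine estimate NE1′ (node O3b/H2) — THE SOURCE PENCIL OF THE DRESSED SMALL-FIELD OUTPUT IN PRINT'S
# LETTERS: the observable-attached part of `E^{(k+1)}(X)` and the regeneration constant WITH (2.41)'s decay, and the two
# binders of `DressedSmallFieldAllowance` («output analytic on the source disc, bounded by M») FED from per-polymer data
# by the tree's Kotecký–Preiss kernels BY NAME

Cell `pub-balaban`, sub-cell `t4`, BINDER-OWNERS row NE1′; owner lineage t4-ne1p-p1 (PROVER seat P1, technique «RG-trajectory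
comparison: extend B12's (2.18) inductive representation term by term with the observable insertion, tracking μ-uniformity
through the printed small-field bounds»), generation 26; ADDITIVE — imports `Literature/…/Balaban1983to89/T4ActivityLipschitz`
(node U3's activity-Lipschitz ∕ pencil kernel with its [cite]-tagged reproduction of [Balaban1988RGII] (2.39)–(2.41)) and
`Spine/NE1p/DressedSmallFieldSeries` (p219191) ONLY; THEOREMS ONLY.

WHY THIS FILE.  The wall of record (T4-DAG v33 §8 Q42, wording «v1.5»: NE1′ ⇐ (w1) ∧ (I4′) ∧ (w5)∕(w5b) ∧ PAY∕allowance ∧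
(w3)⁺∕(w4)∕(w6)∕(w7)) says in two places «modulo the UNPRINTED μ∕strength-extension of [Balaban1988RGII]'s activity bounds»:
the regeneration constant (w5) `c̄ = 2M/ε` (`DressedSmallFieldAllowance.regen_le_of_slack`, p218876) and the small-field allowance
(`muPart_norm_le_of_window`, `muDeriv_norm_le_of_window`) take as BINDERS «the dressed output `E` is analytic on the source disc
and bounded by `M` there»; `DressedSmallFieldSeries` relocated them to per-term data (E1)∕(E2)∕(E3).  THIS FILE discharges the
OUTPUT level from the POLYMER level, in print's letters and BY NAME: given dressed ACTIVITIES `act s Z` (source `s`, polymer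
`Z`) complex differentiable on the source disc polymer by polymer ((E1), binder `hhol`) under a SOURCE-FREE majorant of the
(2.38)-shape ((E2) `‖act s Z‖ ≤ m Z`, binder `hm`; Lemma 3's shape `m Z ≤ A·e^{−R d(Z)}`, binder `hL3`), the tree's ONE-RUN
kernel `B13Resummation.norm_locE_le_of_small` ((2.38) + (1.26) + (2.27) + (2.30) ⇒ (2.39)–(2.41), Kotecký–Preiss) and node U3's
PENCIL kernel `T4ActivityLipschitz.norm_locE_sub_locE_le_of_pencil_small` (the same along a holomorphic family of activity
families, Cauchy in the pencil parameter — no majorant doubled, nothing halved) give: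
* §1 `muPart_locE_le` — for `0 < μ₀ < μ₁`, `‖μ‖ ≤ μ₀`: `‖E_μ(X) − E_0(X)‖ ≤ (e ν c₁ K₀² · A · e^{−r₁ d(X)}) · μ₀/(μ₁ − μ₀)`,
  the observable-attached part of the dressed small-field output WITH (2.41)'s decay in `d_{k+1}(X)` (the abstract `2Mμ₀/μ₁`
  of `muPart_norm_le_of_window` carried no decay) — pencil `z ↦ act (z·μ)` of radius `μ₁/μ₀`; `norm_locE_le_of_majorant` —
  the μ-UNIFORM (2.41) envelope `‖E_s(X)‖ ≤ e ν c₁ K₀² · A · e^{−r₁ d(X)}` on the whole disc (the allowance's `M`, with decay,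
  uniform because the majorant is source-free); `regenPart_locE_le` — the STRENGTH pencil (`s = 1`: a booked family's content
  on, `s = 0`: off, radius `ϱ = ε/σ` = slack over the family's booked size): the (w5) regeneration constant in the print-shaped
  form `M/(ϱ − 1) = M·σ/(ε − σ)`, with decay.
* §2 `differentiableOn_locE_of_majorant` — `s ↦ E_s(X)` IS complex differentiable on the whole source disc: B13's `kp_condition`
  gives [KP86] (1) for `act s` (truncated to the polymers inside `X`) UNIFORMLY in `s`; [KP86]'s theorem gives zero-freeness of
  every ray of every sub-volume partition function (tree `polymerPartitionFunction_ne_zero_of_kp`); so every `log Z(B; act s)`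
  is holomorphic in `s` (tree `differentiableOn_polymerLogZ_param`), hence every truncated functional (finite alternating sum)
  and `locE` (finite sum over the covering families); whence `muDeriv_locE_le` — the linear response `≤ 2M/(μ₁ − μ₀)` with
  `DressedSmallFieldAllowance.muDeriv_norm_le_of_window` BY NAME, BOTH its binders FED — and `muPart_locE_le_schwarz` (the
  allowance's own Schwarz form, same feeding; weaker than §1 by `2(μ₁ − μ₀)/μ₁`, recorded for consistency).
After this file the two allowance binders are no longer hypotheses about «the output»: they follow from (E1)∕(E2) per polymer +
Lemma 3's SHAPE for the majorant + B13's geometry + the clauses.  The companion `DressedSmallFieldShape` (N0k, same generation)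
supplies (E1)∕(E2) from the (2.14)-SHAPE of the activities read along the dressed potential table.

WHAT REMAINS DISPLAYED (binders, by name in every theorem; NOTHING instantiated on Bałaban's densities):
(b1) `hhol`∕`hm` — (E1)∕(E2) per polymer [→ `DressedSmallFieldShape`: the dressed table's analyticity ∕ radius on the source
disc = (w1) + (w6)];  (b2) `hL3 : m Z ≤ A·e^{−R d(Z)}` — [Balaban1988RGII] Lemma 3 (2.38) p. 20 for the SOURCE-FREE majorant at
the DRESSED constant `A` [printed TYPE for Bałaban's one table 𝐕_k («|H(Z)| ≤ C₃ε₁ exp(−(1 − 8δ)½Lκd_{k+1}(Z))», with p. 20's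
`C₃ ∝ E₀`); for the dressed data the CELL's re-run at `E₀ ↦ E₀ + D₀` (`D₀` = the observable-attached terms' uniform size on the
source disc) — the SAME uniformity binder as node U3∕NE9's `T4HistoryLipschitzActivity.ClusterGeom.PotentialKP` («(2.38) for
potential tables other than Bałaban's own 𝐕_k», GAPS G-ne9p2-5): ONE unprinted item serves rows NE9 (a ball of tables) and NE1′
(the dressed curve inside that ball)];  (b3) B13's geometry — footprint-local incompatibility `hloc`∕`hreach`, (1.26) `Ineq126`,
(2.30) `VolBound`, (2.27) `Ineq227` — the tree's `B13FamilySum` shapes (printed; instantiated on Bałaban's `d_k` by nobody yet,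
as in `B13Resummation`);  (b4) the clauses `hrate : r₁ + 2κ₀ + 2 ≤ R`, `hsmall : A·e^{b+1}K₀νc₁ ≤ 1` — p. 21 «κ sufficiently
large, ε₁ sufficiently small» ∕ «O(1)C₃ε₁ ≤ ½E₀» at the dressed `A` = ARITHMETIC (`DressedSmallFieldAllowance.sfClause_*`).
NOT CLAIMED: (2.38) for the dressed activities (it is (b2)); that B13's `d_k` satisfies (b3); anything at met ∕ large-field steps
(σ-route, `DressedSigmaRoute` p217353); NE1′.

HONEST FRAMING.  Kernel bookkeeping over SHAPES — one-variable complex analysis and the tree's cluster-expansion theorems composed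
BY NAME; printed loci are TYPE∕CONTEXT only ([Balaban1988RGII] = B13, CMP 116 (1988) 1–22: (2.13) p. 14, (2.14)–(2.15)
p. 15, (2.38) p. 20, (2.39)–(2.41) p. 21 — reproduced with [cite] tags in `B13Resummation` ∕ `T4ActivityLipschitz`, not
re-asserted here); ABSOLUTE RULE honoured ([folklore] kernel lemmas; no disputed step of the audited manuscripts enters as a
fact).  NE1′ NOT printed, NOT proved; 0 leaves instantiated; spine PROVED 0∕9; count 9 unchanged.  Rung (B)+1 on ONE finite
four-torus — NOT infinite volume, NOT a mass gap, NOT OS on ℝ⁴, NOT Clay.  HONEST DEPENDENCY: continuum YM on T⁴ ⇐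
BetaPertH ∧ nine spine estimates (0/9 proved); BetaPertH ⇐ (D1) ∧ (D4) ∧ CAP+tail; G-an2-4 gates asym, D1 and NE2/3/4.
-/

noncomputable section

namespace Summit.QuantumFields.BalabanUV.T4Continuum.NE1p.DressedSmallFieldPencil

open Metric Set Complex
open scoped BigOperators
open Literature.MathematicalPhysics.QuantumFieldTheory.Balaban1983to89.B13FamilySum (Ineq126 VolBound Ineq227)
open Literature.MathematicalPhysics.QuantumFieldTheory.Balaban1983to89.B13Resummation (locE norm_locE_le_of_small)
open Literature.MathematicalPhysics.QuantumFieldTheory.Balaban1983to89.T4ActivityLipschitz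
  (norm_locE_sub_locE_le_of_pencil_small)

/-! ## §1 THE μ-PENCIL OF THE DRESSED SMALL-FIELD OUTPUT IN PRINT'S LETTERS: the observable-attached part of
`E^{(k+1)}(X)` with (2.41)'s decay, from the tree's pencil kernel BY NAME -/

section Pencil

variable {Dom Cube : Type*} [DecidableEq Dom] [DecidableEq Cube] [Fintype Dom]
variable (ι : Dom → Dom → Prop) [DecidableRel ι]

/-- **THE μ-PART OF THE DRESSED SMALL-FIELD OUTPUT, WITH (2.41)'s DECAY** (kernel; the tree's
`T4ActivityLipschitz.norm_locE_sub_locE_le_of_pencil_small` BY NAME on the pencil `z ↦ act (z·μ)` of radius `μ₁/μ₀`).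
Binders: B13's footprint-local incompatibility and geometry (`hloc`, `hreach`, (1.26) `h126`, volume `hvol`, (2.27) `h227`),
the clauses «κ large ∕ ε′ small» (`hrate`, `hsmall` — EXACTLY the one-run conditions of `B13Resummation.norm_locE_le_of_small`
at the DRESSED constant `A`), the dressed activities `act s Z` complex differentiable in the source `s` on the disc `‖s‖ < μ₁`
polymer by polymer ((E1), `hhol`) and dominated there by a source-free majorant `m Z` ((E2), `hm`) which obeys the
(2.38)-shape `m Z ≤ A·e^{−R d(Z)}` (`hL3` — print's Lemma 3 chain (2.15) → (2.38) run at the DRESSED radius: the binder of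
record, asserted for NOTHING here).  Conclusion, for `0 < μ₀ < μ₁` and `‖μ‖ ≤ μ₀`:
`‖E_μ(X) − E_0(X)‖ ≤ (e ν c₁ K₀² · A · e^{−r₁ d(X)}) · μ₀/(μ₁ − μ₀)` — the (2.41) envelope times the pencil factor. -/
theorem muPart_locE_le [Std.Refl ι] [Std.Symm ι] {cubes reach : Dom → Finset Cube} {d : Dom → ℝ} {m : Dom → ℝ}
    {act : ℂ → Dom → ℂ} {A R r₁ κ₀ K₀ c₁ c b ν dX μ₁ μ₀ : ℝ} {X : Finset Cube} {μ : ℂ}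
    (hloc : ∀ Z Z', ι Z' Z → ∃ q ∈ reach Z, q ∈ cubes Z')
    (hreach : ∀ Z, ((reach Z).card : ℝ) ≤ ν * (cubes Z).card)
    (hd : ∀ Z, 0 ≤ d Z) (hA : 0 ≤ A) (hK₀ : 0 ≤ K₀) (hc₁ : 0 ≤ c₁) (hν : 0 ≤ ν) (hκ₀ : 0 ≤ κ₀)
    (hr₁ : 0 ≤ r₁) (hc : 0 ≤ c) (hb : r₁ * c ≤ b)
    (h126 : Ineq126 (Finset.univ : Finset Dom) cubes d κ₀ K₀)
    (hvol : VolBound (Finset.univ : Finset Dom) cubes d c₁)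
    (h227 : Ineq227 (Finset.univ : Finset Dom) cubes d X dX c)
    (hrate : r₁ + 2 * κ₀ + 2 ≤ R) (hsmall : A * Real.exp (b + 1) * K₀ * ν * c₁ ≤ 1) (hX : X.Nonempty)
    (hhol : ∀ Z, cubes Z ⊆ X → DifferentiableOn ℂ (fun s => act s Z) (ball (0 : ℂ) μ₁))
    (hm : ∀ s ∈ ball (0 : ℂ) μ₁, ∀ Z, cubes Z ⊆ X → ‖act s Z‖ ≤ m Z)
    (hL3 : ∀ Z, cubes Z ⊆ X → m Z ≤ A * Real.exp (-(R * d Z)))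
    (h0 : 0 < μ₀) (h01 : μ₀ < μ₁) (hμ : ‖μ‖ ≤ μ₀) :
    ‖locE ι cubes (act μ) X - locE ι cubes (act 0) X‖ ≤
      Real.exp 1 * ν * c₁ * K₀ ^ 2 * A * Real.exp (-(r₁ * dX)) * (μ₀ / (μ₁ - μ₀)) := by
  -- the pencil `z ↦ act (z·μ)` of radius `μ₁/μ₀ > 1`
  have hRz : 1 < μ₁ / μ₀ := (one_lt_div h0).2 h01
  have hin : ∀ z : ℂ, ‖z‖ < μ₁ / μ₀ → z * μ ∈ ball (0 : ℂ) μ₁ := by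
    intro z hz
    rw [mem_ball_zero_iff, norm_mul]
    calc ‖z‖ * ‖μ‖ ≤ ‖z‖ * μ₀ := mul_le_mul_of_nonneg_left hμ (norm_nonneg _)
      _ < μ₁ / μ₀ * μ₀ := mul_lt_mul_of_pos_right hz h0
      _ = μ₁ := div_mul_cancel₀ μ₁ h0.ne'
  have hhol' : ∀ Z, cubes Z ⊆ X → DifferentiableOn ℂ (fun z : ℂ => act (z * μ) Z) (ball (0 : ℂ) (μ₁ / μ₀)) := by
    intro Z hZ
    refine (hhol Z hZ).comp ((differentiable_id.mul_const μ).differentiableOn) fun z hz => ?_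
    exact hin z (mem_ball_zero_iff.1 hz)
  have hw' : ∀ z : ℂ, ‖z‖ < μ₁ / μ₀ → ∀ Z, cubes Z ⊆ X → ‖act (z * μ) Z‖ ≤ A * Real.exp (-(R * d Z)) :=
    fun z hz Z hZ => (hm _ (hin z hz) Z hZ).trans (hL3 Z hZ)
  have h := norm_locE_sub_locE_le_of_pencil_small ι (w := fun z Z => act (z * μ) Z) hloc hreach hd hA hK₀ hc₁ hν
    hκ₀ hr₁ hc hb hRz hhol' hw' h126 hvol h227 hrate hsmall hX
  have h1 : (fun Z => act (1 * μ) Z) = act μ := by funext Z; rw [one_mul]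
  have h0' : (fun Z => act (0 * μ) Z) = act 0 := by funext Z; rw [zero_mul]
  have hfac : (Real.exp 1 * ν * c₁ * K₀ ^ 2 * A * Real.exp (-(r₁ * dX))) / (μ₁ / μ₀ - 1) =
      Real.exp 1 * ν * c₁ * K₀ ^ 2 * A * Real.exp (-(r₁ * dX)) * (μ₀ / (μ₁ - μ₀)) := by
    have hne : μ₁ - μ₀ ≠ 0 := (sub_pos.2 h01).ne'
    field_simp
  calc ‖locE ι cubes (act μ) X - locE ι cubes (act 0) X‖
      = ‖locE ι cubes ((fun z Z => act (z * μ) Z) 1) X - locE ι cubes ((fun z Z => act (z * μ) Z) 0) X‖ := by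
        simp only [h1, h0']
    _ ≤ (Real.exp 1 * ν * c₁ * K₀ ^ 2 * A * Real.exp (-(r₁ * dX))) / (μ₁ / μ₀ - 1) := h
    _ = _ := hfac

/-- **THE SOURCE-UNIFORM (2.41) ENVELOPE OF THE DRESSED OUTPUT** (kernel; `B13Resummation.norm_locE_le_of_small` BY NAME at
every point of the source disc): under the same binders, `‖E_s(X)‖ ≤ e ν c₁ K₀² · A · e^{−r₁ d(X)}` for all `‖s‖ < μ₁` —
the `M` of `DressedSmallFieldAllowance` WITH its decay, μ-UNIFORM because the majorant is source-free. -/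
theorem norm_locE_le_of_majorant [Std.Refl ι] [Std.Symm ι] {cubes reach : Dom → Finset Cube} {d : Dom → ℝ}
    {m : Dom → ℝ} {act : ℂ → Dom → ℂ} {A R r₁ κ₀ K₀ c₁ c b ν dX μ₁ : ℝ} {X : Finset Cube}
    (hloc : ∀ Z Z', ι Z' Z → ∃ q ∈ reach Z, q ∈ cubes Z')
    (hreach : ∀ Z, ((reach Z).card : ℝ) ≤ ν * (cubes Z).card)
    (hd : ∀ Z, 0 ≤ d Z) (hA : 0 ≤ A) (hK₀ : 0 ≤ K₀) (hc₁ : 0 ≤ c₁) (hν : 0 ≤ ν) (hκ₀ : 0 ≤ κ₀)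
    (hr₁ : 0 ≤ r₁) (hc : 0 ≤ c) (hb : r₁ * c ≤ b)
    (h126 : Ineq126 (Finset.univ : Finset Dom) cubes d κ₀ K₀)
    (hvol : VolBound (Finset.univ : Finset Dom) cubes d c₁)
    (h227 : Ineq227 (Finset.univ : Finset Dom) cubes d X dX c)
    (hrate : r₁ + 2 * κ₀ + 2 ≤ R) (hsmall : A * Real.exp (b + 1) * K₀ * ν * c₁ ≤ 1) (hX : X.Nonempty)
    (hm : ∀ s ∈ ball (0 : ℂ) μ₁, ∀ Z, cubes Z ⊆ X → ‖act s Z‖ ≤ m Z)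
    (hL3 : ∀ Z, cubes Z ⊆ X → m Z ≤ A * Real.exp (-(R * d Z))) {s : ℂ} (hs : s ∈ ball (0 : ℂ) μ₁) :
    ‖locE ι cubes (act s) X‖ ≤ Real.exp 1 * ν * c₁ * K₀ ^ 2 * A * Real.exp (-(r₁ * dX)) :=
  norm_locE_le_of_small ι hloc hreach hd hA hK₀ hc₁ hν hκ₀ hr₁ hc hb
    (fun Z hZ => (hm s hs Z hZ).trans (hL3 Z hZ)) h126 hvol h227 hrate hsmall hX

/-- **THE STRENGTH PENCIL = THE REGENERATION CONSTANT (w5) WITH DECAY** (kernel; `muPart_locE_le` at `μ = μ₀ = 1`): if the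
dressed activities are complex differentiable in a STRENGTH parameter `s` on the disc `‖s‖ < ϱ` with `1 < ϱ` (the strength
`s = 1` switching a booked family's content on, `s = 0` off; `ϱ = ε/σ` = slack over the family's booked size) under a
strength-free (2.38)-shape majorant, then the family-sourced part of the output obeys
`‖E_1(X) − E_0(X)‖ ≤ (e ν c₁ K₀² · A · e^{−r₁ d(X)}) / (ϱ − 1)` — `regen_le_of_slack`'s constant `2M/ε·σ` replaced by the
print-shaped `M·σ/(ε − σ)` and carrying (2.41)'s decay in `d_{k+1}(X)`. -/
theorem regenPart_locE_le [Std.Refl ι] [Std.Symm ι] {cubes reach : Dom → Finset Cube} {d : Dom → ℝ} {m : Dom → ℝ}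
    {act : ℂ → Dom → ℂ} {A R r₁ κ₀ K₀ c₁ c b ν dX ϱ : ℝ} {X : Finset Cube}
    (hloc : ∀ Z Z', ι Z' Z → ∃ q ∈ reach Z, q ∈ cubes Z')
    (hreach : ∀ Z, ((reach Z).card : ℝ) ≤ ν * (cubes Z).card)
    (hd : ∀ Z, 0 ≤ d Z) (hA : 0 ≤ A) (hK₀ : 0 ≤ K₀) (hc₁ : 0 ≤ c₁) (hν : 0 ≤ ν) (hκ₀ : 0 ≤ κ₀)
    (hr₁ : 0 ≤ r₁) (hc : 0 ≤ c) (hb : r₁ * c ≤ b)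
    (h126 : Ineq126 (Finset.univ : Finset Dom) cubes d κ₀ K₀)
    (hvol : VolBound (Finset.univ : Finset Dom) cubes d c₁)
    (h227 : Ineq227 (Finset.univ : Finset Dom) cubes d X dX c)
    (hrate : r₁ + 2 * κ₀ + 2 ≤ R) (hsmall : A * Real.exp (b + 1) * K₀ * ν * c₁ ≤ 1) (hX : X.Nonempty)
    (hhol : ∀ Z, cubes Z ⊆ X → DifferentiableOn ℂ (fun s => act s Z) (ball (0 : ℂ) ϱ))
    (hm : ∀ s ∈ ball (0 : ℂ) ϱ, ∀ Z, cubes Z ⊆ X → ‖act s Z‖ ≤ m Z)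
    (hL3 : ∀ Z, cubes Z ⊆ X → m Z ≤ A * Real.exp (-(R * d Z))) (hϱ : 1 < ϱ) :
    ‖locE ι cubes (act 1) X - locE ι cubes (act 0) X‖ ≤
      Real.exp 1 * ν * c₁ * K₀ ^ 2 * A * Real.exp (-(r₁ * dX)) / (ϱ - 1) := by
  have h := muPart_locE_le ι (μ := 1) (μ₀ := 1) hloc hreach hd hA hK₀ hc₁ hν hκ₀ hr₁ hc hb h126 hvol h227 hrate
    hsmall hX hhol hm hL3 one_pos hϱ (by rw [norm_one])
  rwa [one_div, ← div_eq_mul_inv] at h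

end Pencil

/-! ## §2 THE DRESSED OUTPUT IS ANALYTIC IN THE SOURCE (zero-freeness under [KP86] along the disc) — so
`DressedSmallFieldAllowance`'s binder pair «analytic + bounded on the disc» is FED in print's letters, and its linear-response
face fires BY NAME -/

section Response

variable {Dom Cube : Type*} [DecidableEq Dom] [DecidableEq Cube] [Fintype Dom]
variable (ι : Dom → Dom → Prop) [DecidableRel ι]

open Literature.Probability.LatticeModels (truncatedWeight polymerLogZ polymerPartitionFunction IsKPVolume kpTerm
  isKPVolume_of_kpd polymerPartitionFunction_ne_zero_of_kp differentiableOn_polymerLogZ_param)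
open Literature.MathematicalPhysics.QuantumFieldTheory.Balaban1983to89.B13Resummation (kp_condition locE_congr)
open Summit.QuantumFields.BalabanUV.T4Continuum.NE1p.DressedSmallFieldAllowance (muDeriv_norm_le_of_window
  muPart_norm_le_of_window)

/-- **THE DRESSED SMALL-FIELD OUTPUT IS COMPLEX DIFFERENTIABLE IN THE SOURCE ON THE WHOLE DISC** (kernel): under B13's
footprint-locality ∕ (1.26) ∕ volume binders and the one-run clauses of `norm_locE_le_of_small` at the dressed constant `A`,
dressed activities complex differentiable on `‖s‖ < μ₁` under a source-free (2.38)-shape majorant make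
`s ↦ E_s(X) = locE (act s) X` complex differentiable on `‖s‖ < μ₁`.  Proof: B13's `kp_condition` gives [KP86] (1) for the
activities `act s` (truncated to the polymers inside `X`) UNIFORMLY on the disc; [KP86]'s theorem gives zero-freeness of every
ray of every sub-volume partition function (tree `polymerPartitionFunction_ne_zero_of_kp`); so every `log Z(B; act s)` is
holomorphic in `s` (tree `differentiableOn_polymerLogZ_param`), hence every truncated functional (a finite alternating sum)
and `locE` (a finite sum over the covering families). [folklore] -/
theorem differentiableOn_locE_of_majorant [Std.Refl ι] [Std.Symm ι] {cubes reach : Dom → Finset Cube} {d : Dom → ℝ}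
    {m : Dom → ℝ} {act : ℂ → Dom → ℂ} {A R r₁ κ₀ K₀ c₁ c b ν μ₁ : ℝ} {X : Finset Cube}
    (hloc : ∀ Z Z', ι Z' Z → ∃ q ∈ reach Z, q ∈ cubes Z')
    (hreach : ∀ Z, ((reach Z).card : ℝ) ≤ ν * (cubes Z).card)
    (hd : ∀ Z, 0 ≤ d Z) (hA : 0 ≤ A) (hK₀ : 0 ≤ K₀) (hν : 0 ≤ ν) (hκ₀ : 0 ≤ κ₀)
    (hr₁ : 0 ≤ r₁) (hc : 0 ≤ c) (hb : r₁ * c ≤ b)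
    (h126 : Ineq126 (Finset.univ : Finset Dom) cubes d κ₀ K₀)
    (hvol : VolBound (Finset.univ : Finset Dom) cubes d c₁)
    (hrate : r₁ + 2 * κ₀ + 2 ≤ R) (hsmall : A * Real.exp (b + 1) * K₀ * ν * c₁ ≤ 1)
    (hhol : ∀ Z, cubes Z ⊆ X → DifferentiableOn ℂ (fun s => act s Z) (ball (0 : ℂ) μ₁))
    (hm : ∀ s ∈ ball (0 : ℂ) μ₁, ∀ Z, cubes Z ⊆ X → ‖act s Z‖ ≤ m Z)
    (hL3 : ∀ Z, cubes Z ⊆ X → m Z ≤ A * Real.exp (-(R * d Z))) :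
    DifferentiableOn ℂ (fun s => locE ι cubes (act s) X) (ball (0 : ℂ) μ₁) := by
  -- truncate the activities to the polymers inside `X`
  set w' : ℂ → Dom → ℂ := fun s Z => if cubes Z ⊆ X then act s Z else 0 with hw'_def
  have hcongr : ∀ s, locE ι cubes (act s) X = locE ι cubes (w' s) X := fun s =>
    locE_congr ι fun Z hZ => by simp only [hw'_def, hZ, if_true]
  have hhol' : ∀ Z, DifferentiableOn ℂ (fun s => w' s Z) (ball (0 : ℂ) μ₁) := by
    intro Z
    by_cases h : cubes Z ⊆ X
    · simp only [hw'_def, h, if_true]; exact hhol Z h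
    · simp only [hw'_def, h, if_false]; exact differentiableOn_const 0
  have hw'A : ∀ s ∈ ball (0 : ℂ) μ₁, ∀ Z, ‖w' s Z‖ ≤ A * Real.exp (-(R * d Z)) := by
    intro s hs Z
    by_cases h : cubes Z ⊆ X
    · simp only [hw'_def, h, if_true]; exact (hm s hs Z h).trans (hL3 Z h)
    · simp only [hw'_def, h, if_false, norm_zero]; exact mul_nonneg hA (Real.exp_nonneg _)
  -- [KP86] (1) for `w' s`, uniformly on the disc: B13's `kp_condition` with `τ = A e^{b+1} K₀ ν`
  set τ : ℝ := A * Real.exp (b + 1) * K₀ * ν with hτ_def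
  have hτ : 0 ≤ τ := by positivity
  have hb0 : 0 ≤ b := le_trans (mul_nonneg hr₁ hc) hb
  have hsmall' : A * Real.exp (b + τ * c₁) * K₀ * ν ≤ τ := by
    have hexp : Real.exp (b + τ * c₁) ≤ Real.exp (b + 1) := Real.exp_le_exp.2 (by linarith)
    calc A * Real.exp (b + τ * c₁) * K₀ * ν ≤ A * Real.exp (b + 1) * K₀ * ν := by gcongr
      _ = τ := rfl
  have hKP : ∀ s ∈ ball (0 : ℂ) μ₁, ∀ Z ∈ (Finset.univ : Finset Dom),
      ∑ Z' ∈ Finset.univ with ι Z' Z,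
        ‖w' s Z'‖ * Real.exp (τ * ((cubes Z').card : ℝ) + ((r₁ + (κ₀ + 1)) * d Z' + b)) ≤
          τ * ((cubes Z).card : ℝ) := fun s hs Z _ =>
    kp_condition ι hloc hreach hd hA hK₀ hτ (hw'A s hs) h126 hvol (s := r₁ + (κ₀ + 1)) (b := b) (by linarith)
      hsmall' Z
  -- zero-freeness of every ray of every sub-volume partition function along the disc ([KP86] Theorem)
  have hdK : ∀ Z, 0 ≤ (r₁ + (κ₀ + 1)) * d Z + b := fun Z => add_nonneg (mul_nonneg (by linarith) (hd Z)) hb0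
  have hZ : ∀ s ∈ ball (0 : ℂ) μ₁, ∀ B : Finset Dom, ∀ t ∈ Set.Icc (0 : ℝ) 1,
      polymerPartitionFunction ι (fun Z => (t : ℂ) * w' s Z) B ≠ 0 := by
    intro s hs B t ht
    have hKPs : IsKPVolume ι (w' s) (fun Z => τ * ((cubes Z).card : ℝ)) Finset.univ :=
      isKPVolume_of_kpd (a := fun Z => τ * ((cubes Z).card : ℝ)) (d := fun Z => (r₁ + (κ₀ + 1)) * d Z + b) hdK
        (hKP s hs)
    have hKPt : IsKPVolume ι (fun Z => (t : ℂ) * w' s Z) (fun Z => τ * ((cubes Z).card : ℝ)) Finset.univ := by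
      intro Z₀ hZ₀
      refine le_trans (Finset.sum_le_sum fun Z' _ => ?_) (hKPs Z₀ hZ₀)
      unfold kpTerm
      refine mul_le_mul_of_nonneg_right ?_ (Real.exp_nonneg _)
      rw [norm_mul, Complex.norm_real, Real.norm_eq_abs, abs_of_nonneg ht.1]
      exact mul_le_of_le_one_left (norm_nonneg _) ht.2
    exact polymerPartitionFunction_ne_zero_of_kp hKPt (Finset.subset_univ B)
  -- holomorphy of every `log Z(B; w' s)`, of every truncated functional, of `locE`
  have hlog : ∀ B : Finset Dom, DifferentiableOn ℂ (fun s => polymerLogZ ι (w' s) B) (ball (0 : ℂ) μ₁) := fun B =>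
    differentiableOn_polymerLogZ_param (v := w') B isOpen_ball (fun Z _ => hhol' Z) fun s hs t ht => hZ s hs B t ht
  have htw : ∀ C : Finset Dom, DifferentiableOn ℂ (fun s => truncatedWeight ι (w' s) C) (ball (0 : ℂ) μ₁) := by
    intro C
    unfold truncatedWeight
    exact DifferentiableOn.fun_sum fun B _ => (differentiableOn_const _).mul (hlog B)
  have hE : DifferentiableOn ℂ (fun s => locE ι cubes (w' s) X) (ball (0 : ℂ) μ₁) := by
    unfold locE
    exact DifferentiableOn.fun_sum fun C _ => htw C
  exact hE.congr fun s _ => hcongr s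

/-- **LINEAR RESPONSE OF THE DRESSED SMALL-FIELD OUTPUT IN PRINT'S LETTERS** (kernel; `DressedSmallFieldAllowance.
muDeriv_norm_le_of_window` BY NAME, its two binders FED by `differentiableOn_locE_of_majorant` and
`norm_locE_le_of_majorant`): on the strict sub-window `‖μ‖ ≤ μ₀ < μ₁` the source-derivative of `E_s(X)` is
`≤ 2·(e ν c₁ K₀² · A · e^{−r₁ d(X)})/(μ₁ − μ₀)`. -/
theorem muDeriv_locE_le [Std.Refl ι] [Std.Symm ι] {cubes reach : Dom → Finset Cube} {d : Dom → ℝ}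
    {m : Dom → ℝ} {act : ℂ → Dom → ℂ} {A R r₁ κ₀ K₀ c₁ c b ν dX μ₁ μ₀ : ℝ} {X : Finset Cube} {μ : ℂ}
    (hloc : ∀ Z Z', ι Z' Z → ∃ q ∈ reach Z, q ∈ cubes Z')
    (hreach : ∀ Z, ((reach Z).card : ℝ) ≤ ν * (cubes Z).card)
    (hd : ∀ Z, 0 ≤ d Z) (hA : 0 ≤ A) (hK₀ : 0 ≤ K₀) (hc₁ : 0 ≤ c₁) (hν : 0 ≤ ν) (hκ₀ : 0 ≤ κ₀)
    (hr₁ : 0 ≤ r₁) (hc : 0 ≤ c) (hb : r₁ * c ≤ b)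
    (h126 : Ineq126 (Finset.univ : Finset Dom) cubes d κ₀ K₀)
    (hvol : VolBound (Finset.univ : Finset Dom) cubes d c₁)
    (h227 : Ineq227 (Finset.univ : Finset Dom) cubes d X dX c)
    (hrate : r₁ + 2 * κ₀ + 2 ≤ R) (hsmall : A * Real.exp (b + 1) * K₀ * ν * c₁ ≤ 1) (hX : X.Nonempty)
    (hhol : ∀ Z, cubes Z ⊆ X → DifferentiableOn ℂ (fun s => act s Z) (ball (0 : ℂ) μ₁))
    (hm : ∀ s ∈ ball (0 : ℂ) μ₁, ∀ Z, cubes Z ⊆ X → ‖act s Z‖ ≤ m Z)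
    (hL3 : ∀ Z, cubes Z ⊆ X → m Z ≤ A * Real.exp (-(R * d Z))) (h01 : μ₀ < μ₁) (hμ : ‖μ‖ ≤ μ₀) :
    ‖deriv (fun s => locE ι cubes (act s) X) μ‖ ≤
      2 * (Real.exp 1 * ν * c₁ * K₀ ^ 2 * A * Real.exp (-(r₁ * dX))) / (μ₁ - μ₀) :=
  muDeriv_norm_le_of_window (E := fun s => locE ι cubes (act s) X)
    (differentiableOn_locE_of_majorant ι hloc hreach hd hA hK₀ hν hκ₀ hr₁ hc hb h126 hvol hrate hsmall hhol hm hL3)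
    (fun _ hs => norm_locE_le_of_majorant ι hloc hreach hd hA hK₀ hc₁ hν hκ₀ hr₁ hc hb h126 hvol h227 hrate hsmall hX
      hm hL3 hs) h01 hμ

/-- **CONSISTENCY WITH THE ABSTRACT ALLOWANCE** (kernel; `DressedSmallFieldAllowance.muPart_norm_le_of_window` BY NAME with
its binders fed in print's letters): the Schwarz-lemma form `‖E_μ(X) − E_0(X)‖ ≤ 2M·μ₀/μ₁` with
`M = e ν c₁ K₀² · A · e^{−r₁ d(X)}` — weaker than §1's pencil form by the factor `2(μ₁ − μ₀)/μ₁` but through the SAME two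
binders, so the g25 allowance arithmetic applies verbatim to the print-shaped `M`. -/
theorem muPart_locE_le_schwarz [Std.Refl ι] [Std.Symm ι] {cubes reach : Dom → Finset Cube} {d : Dom → ℝ}
    {m : Dom → ℝ} {act : ℂ → Dom → ℂ} {A R r₁ κ₀ K₀ c₁ c b ν dX μ₁ μ₀ : ℝ} {X : Finset Cube} {μ : ℂ}
    (hloc : ∀ Z Z', ι Z' Z → ∃ q ∈ reach Z, q ∈ cubes Z')
    (hreach : ∀ Z, ((reach Z).card : ℝ) ≤ ν * (cubes Z).card)
    (hd : ∀ Z, 0 ≤ d Z) (hA : 0 ≤ A) (hK₀ : 0 ≤ K₀) (hc₁ : 0 ≤ c₁) (hν : 0 ≤ ν) (hκ₀ : 0 ≤ κ₀)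
    (hr₁ : 0 ≤ r₁) (hc : 0 ≤ c) (hb : r₁ * c ≤ b)
    (h126 : Ineq126 (Finset.univ : Finset Dom) cubes d κ₀ K₀)
    (hvol : VolBound (Finset.univ : Finset Dom) cubes d c₁)
    (h227 : Ineq227 (Finset.univ : Finset Dom) cubes d X dX c)
    (hrate : r₁ + 2 * κ₀ + 2 ≤ R) (hsmall : A * Real.exp (b + 1) * K₀ * ν * c₁ ≤ 1) (hX : X.Nonempty)
    (hhol : ∀ Z, cubes Z ⊆ X → DifferentiableOn ℂ (fun s => act s Z) (ball (0 : ℂ) μ₁))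
    (hm : ∀ s ∈ ball (0 : ℂ) μ₁, ∀ Z, cubes Z ⊆ X → ‖act s Z‖ ≤ m Z)
    (hL3 : ∀ Z, cubes Z ⊆ X → m Z ≤ A * Real.exp (-(R * d Z))) (h01 : μ₀ < μ₁) (hμ : ‖μ‖ ≤ μ₀) :
    ‖locE ι cubes (act μ) X - locE ι cubes (act 0) X‖ ≤
      2 * (Real.exp 1 * ν * c₁ * K₀ ^ 2 * A * Real.exp (-(r₁ * dX))) * μ₀ / μ₁ :=
  muPart_norm_le_of_window (E := fun s => locE ι cubes (act s) X)
    (differentiableOn_locE_of_majorant ι hloc hreach hd hA hK₀ hν hκ₀ hr₁ hc hb h126 hvol hrate hsmall hhol hm hL3)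
    (fun _ hs => norm_locE_le_of_majorant ι hloc hreach hd hA hK₀ hc₁ hν hκ₀ hr₁ hc hb h126 hvol h227 hrate hsmall hX
      hm hL3 hs) (by positivity) h01 hμ

end Response

end Summit.QuantumFields.BalabanUV.T4Continuum.NE1p.DressedSmallFieldPencil

end
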